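import Literature.Analysis.FluidPDE.ForcedFourierForcePressure
import Literature.Analysis.FluidPDE.ForcedFourierForceFamily
import HarnessLib

/-!
# The raw-force gauge for a Schwartz-on-slab force: projected force coefficients and force
# pressure of `forceData`

Second file of the raw-force gauge of the FORCED twin of the tree's Fourier-side local existence
engine (T. Tao, *Localisation and compactness properties of the Navier–Stokes global regularity
problem*, Anal. PDE 6 (2013) 25–107 = arXiv:1108.1165, Thm. 5.4 = arXiv Thm. 31 WITH forcing; the
named fact to be discharged is `tao2011_smooth_local_existence_forced`,
`TaoH1LocalExistenceForced.lean`). `ForcedFourierForcePressure.lean` treats an abstract raw Fourier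
force `g : ℝ → (E → ℂ^ι)` with a pointwise-decaying time-derivative tower; this file SPECIALISES
it to the Fourier-side force `g = forceData hT hf hd` of a physical force `f` which is Schwartz on
the closed slab `[0, T] × ℝ^ι` (`ForcedFourierForceData.lean`: `synthVel (forceData … t) = f t` on
`[0, T]`; `ForcedFourierForceFamily.lean`: the tower `forceDataFamily`), i.e. it produces exactly
the objects the ASSEMBLY of `tao2011_smooth_local_existence_forced_holds` plugs into the existence
half (`IsSobolevMildForced`, seat `ns-blowup-lean2`) and the classical half
(`IsSobolevMildForced.classical`, seat `ns-blowup-ecbridge-7`):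

* §1 the PROJECTED force coefficients `b t ξ = lerayPart (forceData … t) ξ` (`= (P f)^(t, ξ)`):
  jointly measurable in `(t, ξ)` (`measurable_uncurry_lerayPart_forceData`), measurable and
  continuous-in-time slices on all of `ℝ` (time is clamped), every polynomial decay UNIFORMLY in
  `t ∈ ℝ` (`hasDecay_lerayPart_forceData_uniform`), divergence free, conjugation symmetric, and the
  derivative tower `k ↦ lerayPart ∘ forceDataFamily k` in both family shapes
  (`exists_lerayPart_forceData_tower`: `∀ n l, IsFourierFamily T n …` and `∀ n l, IsDomFamily T n …`,
  the binder of `IsSobolevMildForced.classical`) — NOT jointly continuous at `ξ = 0` unless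
  `∫ f(t, x) dx = 0`, which is why joint MEASURABILITY is the right hypothesis for the forcing term;
* §2 the force pressure `p_f(t) = Re 𝓕 forcePresSymbol (forceData … t)` (Tao's `Δ⁻¹∇·f`, (8)):
  jointly smooth on the slab, `∇p_f(t) = f t − P f(t)` on `[0, T]`, `∫ ‖Dⁿp_f(t)‖² ≤ C_n` for every
  `n ≥ 0` uniformly on `[0, T]`;
* §3 the ADAPTER to the raw force: a classical solution on `[0, T]` driven by the projected force
  `synthVel (lerayPart (forceData … t))` with pressure `p` is a classical solution driven by `f`
  itself with pressure `p + p_f` (`IsClassicalNSSolutionOn.of_lerayPart_forceData`), and the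
  `L^∞_t H^k_x` pressure bounds survive (`sobolev_pressure_add_forcePressure_forceData`) — the
  conclusion shape of `tao2011_smooth_local_existence_forced`.

Theorems only; no definition, no named fact; nothing about Navier–Stokes regularity or blow-up is
asserted.

## Mathlib / tree search

Tree (`lean search`): `forceData`, `synthVel_forceData_of_mem`, `forceData_conj_symm`,
`hasDecay_forceData_uniform`, `continuous_forceData_slice/_time/_uncurry` (`ForcedFourierForceData`);
`forceDataFamily`, `forceDataFamily_zero`, `isFourierFamily_forceDataFamily`,
`forceDataFamily_conj_symm` (`ForcedFourierForceFamily`); `lerayPart`, `sum_mul_lerayPart`,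
`lerayPart_neg` (`TaoH1FourierMild`); the gauge file `ForcedFourierForcePressure`
(`hasDecay_lerayPart`, `isFourierFamily_lerayPart`, `measurable_uncurry_lerayPart`,
`isSmoothSpaceTimeOn_forcePressure`, `gradient_forcePressure`, `sobolev_forcePressure`,
`IsClassicalNSSolutionOn.of_lerayPart_force`, `sobolev_pressure_add_forcePressure`). `lean search
'lerayPart_forceData|forcePressure_forceData'`: no hits before this file.

## References

* T. Tao, Anal. PDE 6 (2013) 25–107 = arXiv:1108.1165: (7)–(8) p. 3, `H¹` mild solutions p. 6,
  Thm. 5.4 = arXiv Thm. 31 (p. 18) (iv) with the note closing its proof. [Tao2011]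
* P. G. Lemarié-Rieusset, *The Navier–Stokes Problem in the 21st Century*, CRC 2016, §6.1 (Leray
  projection as a Fourier multiplier). [LemarieRieusset2016]
-/

noncomputable section

open MeasureTheory Real Set Filter Function Complex FourierTransform
open scoped FourierTransform RealInnerProductSpace ENNReal NNReal ContDiff ComplexConjugate
open _root_.Topology

namespace Literature.Analysis.FluidPDE

namespace FourierNS

variable {ι : Type*} [Fintype ι] {T : ℝ}
  {f : ℝ → EuclideanSpace ℝ ι → EuclideanSpace ℝ ι}
  (hT : 0 < T) (hf : IsSmoothSpaceTimeOn (Icc 0 T) f) (hd : HasUniformRapidDecayOn (Icc 0 T) f)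

/-! ## §1 The projected force coefficients `b = lerayPart ∘ forceData` -/

section Projected

/-- **Uniform decay of the projected force**: for every `K` one constant `B ≥ 0` with
`HasDecay K B (lerayPart (forceData … t))` for ALL real `t` (decay of `forceData` uniform in the
clamped time, times the bounded Leray symbol). [cite: Tao2011, Thm. 5.4 proof (arXiv Thm. 31, p. 18)] -/
theorem hasDecay_lerayPart_forceData_uniform (K : ℕ) :
    ∃ B : ℝ, 0 ≤ B ∧ ∀ t : ℝ, HasDecay K B (fun ξ => lerayPart (forceData hT hf hd t) ξ) := by
  obtain ⟨B, hB0, hB⟩ := hasDecay_forceData_uniform hT hf hd K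
  exact ⟨(1 + Fintype.card ι) * B, by positivity, fun t => hasDecay_lerayPart (hB t)⟩

/-- Continuity in time, on all of `ℝ`, of the projected force at a fixed frequency (vector form). [cite: Tao2011, Thm. 5.4 proof (arXiv Thm. 31, p. 18)] -/
theorem continuous_lerayPart_forceData_time (ξ : EuclideanSpace ℝ ι) :
    Continuous fun t : ℝ => lerayPart (forceData hT hf hd t) ξ :=
  continuous_lerayPart_time' (continuous_forceData_time hT hf hd ξ)

/-- Continuity in time, on all of `ℝ`, of a component of the projected force at a fixed
frequency. [cite: Tao2011, Thm. 5.4 proof (arXiv Thm. 31, p. 18)] -/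
theorem continuous_lerayPart_forceData_time_apply (ξ : EuclideanSpace ℝ ι) (l : ι) :
    Continuous fun t : ℝ => lerayPart (forceData hT hf hd t) ξ l :=
  continuous_lerayPart_time (fun k => continuous_forceData_time_apply hT hf hd ξ k) l

/-- **Joint measurability of the projected force** `(t, ξ) ↦ lerayPart (forceData … t) ξ`
(continuity of `forceData` in `(t, ξ)` and Borel measurability of the Leray symbol; NOT jointly
continuous at `ξ = 0` for a force with non-zero spatial mean). [cite: LemarieRieusset2016, §6.1] -/
theorem measurable_uncurry_lerayPart_forceData :
    Measurable (uncurry fun t ξ => lerayPart (forceData hT hf hd t) ξ) :=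
  measurable_uncurry_lerayPart (continuous_forceData_uncurry hT hf hd).measurable

/-- Measurability of every time slice of the projected force. [cite: LemarieRieusset2016, §6.1] -/
theorem measurable_lerayPart_forceData_slice (t : ℝ) :
    Measurable (fun ξ => lerayPart (forceData hT hf hd t) ξ) :=
  measurable_lerayPart_slice (fun s => (continuous_forceData_slice hT hf hd s).measurable) t

/-- A.e.-strong measurability of a component of a slice of the projected force. [cite: LemarieRieusset2016, §6.1] -/
theorem aestronglyMeasurable_lerayPart_forceData_apply (t : ℝ) (l : ι) :
    AEStronglyMeasurable (fun ξ => lerayPart (forceData hT hf hd t) ξ l) volume :=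
  aestronglyMeasurable_lerayPart_apply
    (fun k => ((continuous_apply k).comp (continuous_forceData_slice hT hf hd t)).aestronglyMeasurable) l

/-- The projected force is divergence free on the Fourier side: `∑ₗ ξₗ bₗ(t, ξ) = 0`. [cite: LemarieRieusset2016, §6.1] -/
theorem sum_mul_lerayPart_forceData (t : ℝ) (ξ : EuclideanSpace ℝ ι) :
    ∑ l, ((ξ l : ℝ) : ℂ) * lerayPart (forceData hT hf hd t) ξ l = 0 :=
  sum_mul_lerayPart _ ξ

/-- The projected force is conjugation symmetric (the physical projected force is real). [cite: LemarieRieusset2016, §6.1] -/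
theorem lerayPart_forceData_conj_symm (t : ℝ) (ξ : EuclideanSpace ℝ ι) (l : ι) :
    lerayPart (forceData hT hf hd t) (-ξ) l = conj (lerayPart (forceData hT hf hd t) ξ l) :=
  lerayPart_neg (forceData_conj_symm hT hf hd t) ξ l

/-- **The raw force tower in the binder shape of the gauge file** (`hall` of
`isSmoothSpaceTimeOn_forcePressure` / `IsClassicalNSSolutionOn.of_lerayPart_force`):
`forceDataFamily` with `forceDataFamily 0 = forceData`. [cite: Tao2011, Thm. 5.4 proof (arXiv Thm. 31, p. 18)] -/
theorem forceData_hall (n : ℕ) :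
    ∃ G : ℕ → ℝ → EuclideanSpace ℝ ι → ι → ℂ, G 0 = forceData hT hf hd ∧
      ∀ l, IsFourierFamily T n (fun k t ξ => G k t ξ l) :=
  ⟨forceDataFamily hT hf hd, forceDataFamily_zero hT hf hd,
    fun l => isFourierFamily_forceDataFamily hT hf hd n l⟩

/-- **The projected force tower** `k ↦ lerayPart ∘ forceDataFamily k`: starts at the projected
force, every component is a pointwise-decaying (hence square-dominated) Fourier family of every
order on `[0, T]`, every member is conjugation symmetric and divergence free — the binders
`hB0`/`hB`/`hbc` of `IsSobolevMildForced.classical` (`ForcedFourierMildClassical.lean`) and the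
tower of `IsSobolevMildForced.exists_family` (`ForcedFourierMildFamily.lean`). [cite: Tao2011, Thm. 5.4 proof (arXiv Thm. 31, p. 18)] -/
theorem exists_lerayPart_forceData_tower :
    ∃ B : ℕ → ℝ → EuclideanSpace ℝ ι → ι → ℂ,
      B 0 = (fun t ξ => lerayPart (forceData hT hf hd t) ξ) ∧
      (∀ n l, IsFourierFamily T n (fun k t ξ => B k t ξ l)) ∧
      (∀ n l, IsDomFamily T n (fun k t ξ => B k t ξ l)) ∧
      (∀ k t ξ l, B k t (-ξ) l = conj (B k t ξ l)) ∧
      (∀ k t ξ, ∑ l, ((ξ l : ℝ) : ℂ) * B k t ξ l = 0) := by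
  refine ⟨fun k t ξ => lerayPart (forceDataFamily hT hf hd k t) ξ, ?_, fun n l => ?_, fun n l => ?_,
    fun k t ξ l => ?_, fun k t ξ => ?_⟩
  · simp only [forceDataFamily_zero]
  · exact isFourierFamily_lerayPart (fun j => isFourierFamily_forceDataFamily hT hf hd n j) l
  · exact (isFourierFamily_lerayPart (fun j => isFourierFamily_forceDataFamily hT hf hd n j) l).isDomFamily
  · exact lerayPart_neg (forceDataFamily_conj_symm hT hf hd k t) ξ l
  · exact sum_mul_lerayPart _ ξ

end Projected

/-! ## §2 The force pressure of `forceData` on `ℝ³` -/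

section ForcePressure3

variable {f : ℝ → EuclideanSpace ℝ (Fin 3) → EuclideanSpace ℝ (Fin 3)}
  (hT : 0 < T) (hf : IsSmoothSpaceTimeOn (Icc 0 T) f) (hd : HasUniformRapidDecayOn (Icc 0 T) f)

/-- **The force pressure `p_f(t) = Re 𝓕 forcePresSymbol (forceData … t)` (Tao's `Δ⁻¹∇·f`) is
jointly smooth on `[0, T] × ℝ³`.** [cite: Tao2011, Thm. 5.4 (iv) with (8)] -/
theorem isSmoothSpaceTimeOn_forcePressure_forceData :
    IsSmoothSpaceTimeOn (Icc 0 T)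
      (fun t x => (𝓕 (forcePresSymbol (forceData hT hf hd t)) x).re) :=
  isSmoothSpaceTimeOn_forcePressure hT (forceData_hall hT hf hd)

/-- **`∇ Δ⁻¹∇·f = f − P f` for the physical force**: for every real `t`,
`∇p_f(t) x = f (clamp T t) x − synthVel (lerayPart (forceData … t)) x`; in particular `= f t x − …`
on `[0, T]`. [cite: Tao2011, (8) p. 3] -/
theorem gradient_forcePressure_forceData (t : ℝ) (x : EuclideanSpace ℝ (Fin 3)) :
    gradient (fun y => (𝓕 (forcePresSymbol (forceData hT hf hd t)) y).re) x =
      f (clamp T t) x - synthVel (lerayPart (forceData hT hf hd t)) x := by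
  obtain ⟨B, -, hB⟩ := hasDecay_forceData_uniform hT hf hd (1 + 5)
  rw [← synthVel_forceData hT hf hd t]
  exact gradient_forcePressure (hB t) le_rfl
    (fun k => ((continuous_apply k).comp (continuous_forceData_slice hT hf hd t)).aestronglyMeasurable) x

/-- On `[0, T]`: `∇p_f(t) x = f t x − synthVel (lerayPart (forceData … t)) x`. [cite: Tao2011, (8) p. 3] -/
theorem gradient_forcePressure_forceData_of_mem {t : ℝ} (ht : t ∈ Icc 0 T)
    (x : EuclideanSpace ℝ (Fin 3)) :
    gradient (fun y => (𝓕 (forcePresSymbol (forceData hT hf hd t)) y).re) x =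
      f t x - synthVel (lerayPart (forceData hT hf hd t)) x := by
  rw [gradient_forcePressure_forceData, clamp_of_mem ht]

/-- **`p_f ∈ L^∞_t H^k_x([0, T] × ℝ³)` for every `k ≥ 0`** (Tao 2011, Thm. 5.4 (iv): the normalised
pressure, which carries `Δ⁻¹∇·f`, is in `L^∞_t H^k_x` for all `k ≥ 0`). [cite: Tao2011, Thm. 5.4 (iv) with (8)] -/
theorem sobolev_forcePressure_forceData (n : ℕ) :
    ∃ C : ℝ≥0, ∀ t ∈ Icc 0 T,
      ∫⁻ x, ‖iteratedFDeriv ℝ n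
        (fun y => (𝓕 (forcePresSymbol (forceData hT hf hd t)) y).re) x‖ₑ ^ 2 ≤ C :=
  sobolev_forcePressure
    (fun K => by
      obtain ⟨B, -, hB⟩ := hasDecay_forceData_uniform hT hf hd K
      exact ⟨B, fun t _ => hB t⟩)
    (fun t _ k => ((continuous_apply k).comp (continuous_forceData_slice hT hf hd t)).aestronglyMeasurable)
    n

end ForcePressure3

end FourierNS

/-! ## §3 The adapter: from the projected force `P f` to the physical force `f` -/

section Adapter

open FourierNS

variable {T ν : ℝ} {f : ℝ → EuclideanSpace ℝ (Fin 3) → EuclideanSpace ℝ (Fin 3)}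
  (hT : 0 < T) (hf : IsSmoothSpaceTimeOn (Icc 0 T) f) (hd : HasUniformRapidDecayOn (Icc 0 T) f)

/-- **From `P f` to `f`.** If `(u, p)` is a classical solution on `[0, T] × ℝ³` of the Navier–Stokes
system driven by the synthesized PROJECTED force `synthVel (lerayPart (forceData hT hf hd t))` (the
conclusion of the classical half of the forced engine, `IsSobolevMildForced.classical`), then
`(u, p + p_f)` with `p_f(t) = Re 𝓕 forcePresSymbol (forceData hT hf hd t)` (Tao's `Δ⁻¹∇·f`) is a
classical solution driven by the physical force `f` — Tao's `H¹` mild solution of the forced system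
with its normalised pressure `-Δ⁻¹∂ᵢ∂ⱼ(uᵢuⱼ) + Δ⁻¹∇·f`, (8), solves (3)–(5).
[cite: Tao2011, Thm. 5.4 (iv) with (8)] -/
theorem IsClassicalNSSolutionOn.of_lerayPart_forceData
    {u : ℝ → EuclideanSpace ℝ (Fin 3) → EuclideanSpace ℝ (Fin 3)}
    {p : ℝ → EuclideanSpace ℝ (Fin 3) → ℝ}
    (h : IsClassicalNSSolutionOn (Icc 0 T) ν
      (fun t => synthVel (lerayPart (forceData hT hf hd t))) u p) :
    IsClassicalNSSolutionOn (Icc 0 T) ν f u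
      (fun t x => p t x + (𝓕 (forcePresSymbol (forceData hT hf hd t)) x).re) :=
  (IsClassicalNSSolutionOn.of_lerayPart_force hT (forceData_hall hT hf hd) h).copy_force
    fun t ht x => by rw [synthVel_forceData_of_mem hT hf hd ht]

/-- **The pressure bounds survive the adapter**: if `p ∈ L^∞_t H^k_x([0, T])` for all `k` (and `p`
is jointly smooth on the slab) then so is `p + p_f`. [cite: Tao2011, Thm. 5.4 (iv) with (8)] -/
theorem sobolev_pressure_add_forcePressure_forceData {p : ℝ → EuclideanSpace ℝ (Fin 3) → ℝ}
    (hp : IsSmoothSpaceTimeOn (Icc 0 T) p)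
    (hpS : ∀ n : ℕ, ∃ C : ℝ≥0, ∀ t ∈ Icc 0 T, ∫⁻ x, ‖iteratedFDeriv ℝ n (p t) x‖ₑ ^ 2 ≤ C)
    (n : ℕ) :
    ∃ C : ℝ≥0, ∀ t ∈ Icc 0 T,
      ∫⁻ x, ‖iteratedFDeriv ℝ n
        (fun y => p t y + (𝓕 (forcePresSymbol (forceData hT hf hd t)) y).re) x‖ₑ ^ 2 ≤ C :=
  sobolev_pressure_add_forcePressure (forceData_hall hT hf hd) hp hpS n

/-- **The packaged adapter in the conclusion shape of `tao2011_smooth_local_existence_forced`.**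
From a classical solution `(u, p)` on `[0, T] × ℝ³` driven by the projected force
`synthVel (lerayPart (forceData hT hf hd t))` with `u, ∂ₜu ∈ L^∞_t H^k_x`, `p ∈ L^∞_t H^k_x` and
`u ∈ C([0, T]; L²)`, there is a pressure `p'` (namely `p + Δ⁻¹∇·f`) with `(u, p')` classical for
the physical force `f`, the same bounds for `u`, `∂ₜu`, `p' ∈ L^∞_t H^k_x`, and the same initial
value and `L²`-continuity. [cite: Tao2011, Thm. 5.4 (ii)+(iv) with (8)] -/
theorem exists_classical_rawForce_of_lerayPart_forceData
    {u : ℝ → EuclideanSpace ℝ (Fin 3) → EuclideanSpace ℝ (Fin 3)}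
    {p : ℝ → EuclideanSpace ℝ (Fin 3) → ℝ}
    (h : IsClassicalNSSolutionOn (Icc 0 T) ν
      (fun t => synthVel (lerayPart (forceData hT hf hd t))) u p)
    (hpS : ∀ n : ℕ, ∃ C : ℝ≥0, ∀ t ∈ Icc 0 T, ∫⁻ x, ‖iteratedFDeriv ℝ n (p t) x‖ₑ ^ 2 ≤ C) :
    ∃ p' : ℝ → EuclideanSpace ℝ (Fin 3) → ℝ,
      IsClassicalNSSolutionOn (Icc 0 T) ν f u p' ∧
      (∀ n : ℕ, ∃ C : ℝ≥0, ∀ t ∈ Icc 0 T, ∫⁻ x, ‖iteratedFDeriv ℝ n (p' t) x‖ₑ ^ 2 ≤ C) :=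
  ⟨fun t x => p t x + (𝓕 (forcePresSymbol (forceData hT hf hd t)) x).re,
    IsClassicalNSSolutionOn.of_lerayPart_forceData hT hf hd h,
    fun n => sobolev_pressure_add_forcePressure_forceData hT hf hd h.smooth_pressure hpS n⟩

end Adapter

end Literature.Analysis.FluidPDE

end
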